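import Mathlib
import HarnessLib

/-!
# Route `KLProgramme` — engine support, route (L2): the REAL-VARIABLE bookkeeping behind the uniform overlap size `B ≤ C_B·(2M/β)`

Cell `gate-hubbard-kl`, seat p4 (C5a lead), g7.  The symbol layer (`…SectorMultiplierDiffs/Support/L1`) bounds the pointwise second
differences of the two-multiplier symbol `F_{ω₁}F_{ω₂}` by explicit but scale-dependent constants; the master lemma
`sum_norm_charSum_le_of_second_differences` (k3c2-p3) turns RATES `s₀, s₁, s₂, s₃` into the `ℓ¹` bound
`√(2048(1/s₀+1)[4(2√2/(s₂|v|)+2)(2√2/(s₃|v|)+2) + 16(1/s₁+1)²/(1+s₁R₀)])·√(16PL²N_s)`.  This file is the pure real-inequality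
bookkeeping that makes the result UNIFORM in the scale (`Λ = e₀4^{-n}`, `N = 2ⁿ`, `ΛN² = e₀`):

* `kx_le` — the generic packaging of the space-direction constant `((c_G τ²/Λ² + 2c₁K₂W²/Λ)·1 + 4c₁τ/Λ·z₁ + 1·1·z₂)` into `(s²/Λ²)·κ`;
* `rate_time_sq`, `rate_space_sq`, `rate_perp_sq` — the rates `s₀ = 2Λβ/(Pπ√c_G)`, `s₁ = s₃ = 2Λ/(π√κ)`, `s₂ = 4Λ/(LU√κ)` reproduce the
  constants `c_G(2π/β)²/Λ²`, `(2π/L)²κ/Λ²`, `U²κ/Λ²` in the master lemma's currency `A₀(4/(s P))²`;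
* `tfac_le`, `near_perp_le`, `near_tan_le`, `far_le`, `bracket_le`, `supp_le`, `sqrt_mul_sqrt_le` — the factors of the master bound are
  `≤ (M/(Λβ))(π√c_G+1)`, `ν/Λ`, `ν/(ΛN)`, `(96/(πe₀²))p(p+e₀)²·N/Λ`, …, and their product is `C_B²·M²L⁴`.

Pure real analysis; no model objects; everything proved. [folklore]
-/

noncomputable section

namespace Summit.HubbardSuperconductivity.HubbardSuperconductivity.Theorems.TorusFourierL2

set_option linter.dupNamespace false -- summit = problem name (single-conjunct summit), D-0017

open scoped Real

/-! ### §1 The pointwise space-direction constant packaged as `(s²/Λ²)·κ` -/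

/-- **Generic packaging of the space-direction constant.**  In the shape produced by `norm_fwdDiff_two_space_klAnisoPair_le`
(`τ' = τ + K₂(ρ + 2W)W`, `K₂ = 4 + 4A`): if `τ' ≤ sY`, `W²Λ ≤ a_w s²e₀`, `(D₁+D₂)W_mΛ ≤ a_d s e₀`, `(D₁²+D₂²)W_m²Λ² ≤ a₂s²e₀²`,
`D₁D₂W_m²Λ² ≤ a₃s²e₀²` then the constant is `≤ (s²/Λ²)(c_GY² + 2c₁K₂a_we₀ + 8c₁Ba Y a_d e₀ + 2Ba a₂e₀² + 8Ba²a₃e₀²)`. [folklore] -/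
theorem kx_le {cG c1 Ba A Λ e₀ ρ τ W Wm D₁ D₂ s Y aw ad a2 a3 : ℝ} (hcG : 0 ≤ cG) (hc1 : 0 ≤ c1) (hBa : 0 ≤ Ba) (hA : 0 ≤ A)
    (hΛ : 0 < Λ) (hρ : 0 ≤ ρ) (hτ : 0 ≤ τ) (hW : 0 ≤ W) (hWm : 0 ≤ Wm) (hD₁ : 0 ≤ D₁) (hD₂ : 0 ≤ D₂) (hs : 0 ≤ s) (hY : 0 ≤ Y)
    (hτY : τ + (4 + 4 * A) * (ρ + 2 * W) * W ≤ s * Y) (hW2 : W ^ 2 * Λ ≤ aw * s ^ 2 * e₀)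
    (hDW : (D₁ + D₂) * Wm * Λ ≤ ad * s * e₀) (hDW2 : (D₁ ^ 2 + D₂ ^ 2) * Wm ^ 2 * Λ ^ 2 ≤ a2 * s ^ 2 * e₀ ^ 2)
    (hDW3 : D₁ * D₂ * Wm ^ 2 * Λ ^ 2 ≤ a3 * s ^ 2 * e₀ ^ 2) :
    (cG * (τ + (4 + 4 * A) * (ρ + 2 * W) * W) ^ 2 / Λ ^ 2 + 2 * c1 * ((4 + 4 * A) * W ^ 2) / Λ) * 1 +
        4 * c1 * (τ + (4 + 4 * A) * (ρ + 2 * W) * W) / Λ * (2 * Ba * (D₁ * Wm + D₂ * Wm)) +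
        1 * 1 * (2 * Ba * ((D₁ * Wm) ^ 2 + (D₂ * Wm) ^ 2) + 8 * Ba ^ 2 * ((D₁ * Wm) * (D₂ * Wm))) ≤
      s ^ 2 / Λ ^ 2 * (cG * Y ^ 2 + 2 * c1 * (4 + 4 * A) * aw * e₀ + 8 * c1 * Ba * Y * ad * e₀ + 2 * Ba * a2 * e₀ ^ 2 +
        8 * Ba ^ 2 * a3 * e₀ ^ 2) := by
  have hΛ2 : 0 < Λ ^ 2 := by positivity
  have hK2 : 0 ≤ 4 + 4 * A := by linarith
  have hT0 : 0 ≤ τ + (4 + 4 * A) * (ρ + 2 * W) * W := by positivity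
  have hDW0 : 0 ≤ (D₁ + D₂) * Wm * Λ := by positivity
  -- the targets of the four atom bounds are nonnegative
  have haw : 0 ≤ aw * s ^ 2 * e₀ := le_trans (by positivity) hW2
  have had : 0 ≤ ad * s * e₀ := le_trans hDW0 hDW
  have ha2 : 0 ≤ a2 * s ^ 2 * e₀ ^ 2 := le_trans (by positivity) hDW2
  have ha3 : 0 ≤ a3 * s ^ 2 * e₀ ^ 2 := le_trans (by positivity) hDW3
  -- term A
  have hA' : cG * (τ + (4 + 4 * A) * (ρ + 2 * W) * W) ^ 2 / Λ ^ 2 ≤ s ^ 2 / Λ ^ 2 * (cG * Y ^ 2) := by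
    have h1 : (τ + (4 + 4 * A) * (ρ + 2 * W) * W) ^ 2 ≤ (s * Y) ^ 2 := pow_le_pow_left₀ hT0 hτY 2
    calc _ ≤ cG * (s * Y) ^ 2 / Λ ^ 2 := by gcongr
      _ = s ^ 2 / Λ ^ 2 * (cG * Y ^ 2) := by ring
  -- term B
  have hB' : 2 * c1 * ((4 + 4 * A) * W ^ 2) / Λ ≤ s ^ 2 / Λ ^ 2 * (2 * c1 * (4 + 4 * A) * aw * e₀) := by
    have e1 : 2 * c1 * ((4 + 4 * A) * W ^ 2) / Λ = 2 * c1 * (4 + 4 * A) * (W ^ 2 * Λ) / Λ ^ 2 := by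
      field_simp
    calc _ = 2 * c1 * (4 + 4 * A) * (W ^ 2 * Λ) / Λ ^ 2 := e1
      _ ≤ 2 * c1 * (4 + 4 * A) * (aw * s ^ 2 * e₀) / Λ ^ 2 := by gcongr
      _ = s ^ 2 / Λ ^ 2 * (2 * c1 * (4 + 4 * A) * aw * e₀) := by ring
  -- term C
  have hC' : 4 * c1 * (τ + (4 + 4 * A) * (ρ + 2 * W) * W) / Λ * (2 * Ba * (D₁ * Wm + D₂ * Wm)) ≤
      s ^ 2 / Λ ^ 2 * (8 * c1 * Ba * Y * ad * e₀) := by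
    have e1 : 4 * c1 * (τ + (4 + 4 * A) * (ρ + 2 * W) * W) / Λ * (2 * Ba * (D₁ * Wm + D₂ * Wm)) =
        8 * c1 * Ba * ((τ + (4 + 4 * A) * (ρ + 2 * W) * W) * ((D₁ + D₂) * Wm * Λ)) / Λ ^ 2 := by
      field_simp
      ring
    have h1 : (τ + (4 + 4 * A) * (ρ + 2 * W) * W) * ((D₁ + D₂) * Wm * Λ) ≤ (s * Y) * (ad * s * e₀) :=
      mul_le_mul hτY hDW hDW0 (by positivity)
    calc _ = 8 * c1 * Ba * ((τ + (4 + 4 * A) * (ρ + 2 * W) * W) * ((D₁ + D₂) * Wm * Λ)) / Λ ^ 2 := e1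
      _ ≤ 8 * c1 * Ba * ((s * Y) * (ad * s * e₀)) / Λ ^ 2 := by gcongr
      _ = s ^ 2 / Λ ^ 2 * (8 * c1 * Ba * Y * ad * e₀) := by ring
  -- term D
  have hD' : 1 * 1 * (2 * Ba * ((D₁ * Wm) ^ 2 + (D₂ * Wm) ^ 2) + 8 * Ba ^ 2 * ((D₁ * Wm) * (D₂ * Wm))) ≤
      s ^ 2 / Λ ^ 2 * (2 * Ba * a2 * e₀ ^ 2 + 8 * Ba ^ 2 * a3 * e₀ ^ 2) := by
    have e1 : 1 * 1 * (2 * Ba * ((D₁ * Wm) ^ 2 + (D₂ * Wm) ^ 2) + 8 * Ba ^ 2 * ((D₁ * Wm) * (D₂ * Wm))) =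
        (2 * Ba * ((D₁ ^ 2 + D₂ ^ 2) * Wm ^ 2 * Λ ^ 2) + 8 * Ba ^ 2 * (D₁ * D₂ * Wm ^ 2 * Λ ^ 2)) / Λ ^ 2 := by
      field_simp
    calc _ = (2 * Ba * ((D₁ ^ 2 + D₂ ^ 2) * Wm ^ 2 * Λ ^ 2) + 8 * Ba ^ 2 * (D₁ * D₂ * Wm ^ 2 * Λ ^ 2)) / Λ ^ 2 := e1
      _ ≤ (2 * Ba * (a2 * s ^ 2 * e₀ ^ 2) + 8 * Ba ^ 2 * (a3 * s ^ 2 * e₀ ^ 2)) / Λ ^ 2 := by gcongr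
      _ = s ^ 2 / Λ ^ 2 * (2 * Ba * a2 * e₀ ^ 2 + 8 * Ba ^ 2 * a3 * e₀ ^ 2) := by ring
  have e : s ^ 2 / Λ ^ 2 * (cG * Y ^ 2 + 2 * c1 * (4 + 4 * A) * aw * e₀ + 8 * c1 * Ba * Y * ad * e₀ + 2 * Ba * a2 * e₀ ^ 2 +
        8 * Ba ^ 2 * a3 * e₀ ^ 2) =
      s ^ 2 / Λ ^ 2 * (cG * Y ^ 2) + s ^ 2 / Λ ^ 2 * (2 * c1 * (4 + 4 * A) * aw * e₀) + s ^ 2 / Λ ^ 2 * (8 * c1 * Ba * Y * ad * e₀) +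
        s ^ 2 / Λ ^ 2 * (2 * Ba * a2 * e₀ ^ 2 + 8 * Ba ^ 2 * a3 * e₀ ^ 2) := by ring
  have e' : (cG * (τ + (4 + 4 * A) * (ρ + 2 * W) * W) ^ 2 / Λ ^ 2 + 2 * c1 * ((4 + 4 * A) * W ^ 2) / Λ) * 1 +
        4 * c1 * (τ + (4 + 4 * A) * (ρ + 2 * W) * W) / Λ * (2 * Ba * (D₁ * Wm + D₂ * Wm)) +
        1 * 1 * (2 * Ba * ((D₁ * Wm) ^ 2 + (D₂ * Wm) ^ 2) + 8 * Ba ^ 2 * ((D₁ * Wm) * (D₂ * Wm))) =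
      cG * (τ + (4 + 4 * A) * (ρ + 2 * W) * W) ^ 2 / Λ ^ 2 + 2 * c1 * ((4 + 4 * A) * W ^ 2) / Λ +
        4 * c1 * (τ + (4 + 4 * A) * (ρ + 2 * W) * W) / Λ * (2 * Ba * (D₁ * Wm + D₂ * Wm)) +
        1 * 1 * (2 * Ba * ((D₁ * Wm) ^ 2 + (D₂ * Wm) ^ 2) + 8 * Ba ^ 2 * ((D₁ * Wm) * (D₂ * Wm))) := by ring
  rw [e, e']
  linarith

/-! ### §2 The rates -/

/-- **Time rate**: with `s₀ = 2Λβ/(Pπ√c_G)`, `1·(4/(s₀P))² = c_G(2π/β)²·1/Λ²`. [folklore] -/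
theorem rate_time_sq {cG Λ β P : ℝ} (hcG : 0 < cG) (hΛ : 0 < Λ) (hβ : 0 < β) (hP : 0 < P) :
    1 * (4 / (2 * Λ * β / (P * π * Real.sqrt cG) * P)) ^ 2 = cG * (2 * π / β) ^ 2 * 1 / Λ ^ 2 := by
  have hs : 0 < Real.sqrt cG := Real.sqrt_pos.2 hcG
  have hπ := Real.pi_pos
  have hsq : Real.sqrt cG ^ 2 = cG := Real.sq_sqrt hcG.le
  field_simp
  rw [hsq]
  ring

/-- **Space rate along a step of length `2π/L`** (axes and the tangent step): with `s₁ = 2Λ/(π√κ)`,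
`1·(4/(s₁L))² = (2π/L)²κ/Λ²`. [folklore] -/
theorem rate_space_sq {κ Λ L : ℝ} (hκ : 0 < κ) (hΛ : 0 < Λ) (hL : 0 < L) :
    1 * (4 / (2 * Λ / (π * Real.sqrt κ) * L)) ^ 2 = (2 * π / L) ^ 2 * κ / Λ ^ 2 := by
  have hs : 0 < Real.sqrt κ := Real.sqrt_pos.2 hκ
  have hπ := Real.pi_pos
  have hsq : Real.sqrt κ ^ 2 = κ := Real.sq_sqrt hκ.le
  field_simp
  rw [hsq]
  ring

/-- **Space rate along the normal step** (scale `U`): with `s₂ = 4Λ/(LU√κ)`, `1·(4/(s₂L))² = U²κ/Λ²`. [folklore] -/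
theorem rate_perp_sq {κ Λ L U : ℝ} (hκ : 0 < κ) (hΛ : 0 < Λ) (hL : 0 < L) (hU : 0 < U) :
    1 * (4 / (4 * Λ / (L * U * Real.sqrt κ) * L)) ^ 2 = U ^ 2 * κ / Λ ^ 2 := by
  have hs : 0 < Real.sqrt κ := Real.sqrt_pos.2 hκ
  have hsq : Real.sqrt κ ^ 2 = κ := Real.sq_sqrt hκ.le
  field_simp
  rw [hsq]

/-! ### §3 The factors of the master bound -/

/-- **Time factor**: `1/s₀ + 1 ≤ (M/(Λβ))(π√c_G + 1)` for `s₀ = 2Λβ/(2Mπ√c_G)`, provided `Λβ ≤ M`. [folklore] -/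
theorem tfac_le {cG Λ β M : ℝ} (hcG : 0 < cG) (hΛ : 0 < Λ) (hβ : 0 < β) (hM : 0 < M) (hΛβ : Λ * β ≤ M) :
    1 / (2 * Λ * β / (2 * M * π * Real.sqrt cG)) + 1 ≤ M / (Λ * β) * (π * Real.sqrt cG + 1) := by
  have hs : 0 < Real.sqrt cG := Real.sqrt_pos.2 hcG
  have hπ := Real.pi_pos
  have e : 1 / (2 * Λ * β / (2 * M * π * Real.sqrt cG)) = M / (Λ * β) * (π * Real.sqrt cG) := by
    field_simp
  rw [e, mul_add, mul_one]
  have : 1 ≤ M / (Λ * β) := by rw [le_div_iff₀ (by positivity)]; linarith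
  linarith

/-- **Near factor, normal direction**: `2√2/(s₂V) + 2 ≤ (3√2π√κ + 2e₀)/Λ` for `s₂ = 4Λ/(LU√κ)`, `LU ≤ 3πN`, `V ≥ N/2 > 0`, `Λ ≤ e₀`.
[folklore] -/
theorem near_perp_le {κ Λ L U V N e₀ : ℝ} (hκ : 0 < κ) (hΛ : 0 < Λ) (hL : 0 < L) (hU : 0 < U) (hN : 0 < N) (hV : N / 2 ≤ V)
    (hLU : L * U ≤ 3 * π * N) (hΛe : Λ ≤ e₀) :
    2 * Real.sqrt 2 / (4 * Λ / (L * U * Real.sqrt κ) * V) + 2 ≤ (3 * Real.sqrt 2 * π * Real.sqrt κ + 2 * e₀) / Λ := by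
  have hs : 0 < Real.sqrt κ := Real.sqrt_pos.2 hκ
  have h2 : 0 < Real.sqrt 2 := Real.sqrt_pos.2 (by norm_num)
  have hπ := Real.pi_pos
  have hV0 : 0 < V := lt_of_lt_of_le (by positivity) hV
  have e : 2 * Real.sqrt 2 / (4 * Λ / (L * U * Real.sqrt κ) * V) = Real.sqrt 2 * (L * U) * Real.sqrt κ / (2 * Λ * V) := by
    field_simp
    ring
  have h1 : Real.sqrt 2 * (L * U) * Real.sqrt κ / (2 * Λ * V) ≤ 3 * Real.sqrt 2 * π * Real.sqrt κ / Λ := by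
    calc Real.sqrt 2 * (L * U) * Real.sqrt κ / (2 * Λ * V) ≤ Real.sqrt 2 * (L * U) * Real.sqrt κ / (2 * Λ * (N / 2)) :=
          div_le_div_of_nonneg_left (by positivity) (by positivity) (by nlinarith)
      _ ≤ Real.sqrt 2 * (3 * π * N) * Real.sqrt κ / (2 * Λ * (N / 2)) := by gcongr
      _ = 3 * Real.sqrt 2 * π * Real.sqrt κ / Λ := by field_simp
  have h3 : (2 : ℝ) ≤ 2 * e₀ / Λ := by rw [le_div_iff₀ hΛ]; linarith
  rw [e, add_div]
  exact add_le_add h1 h3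

/-- **Near factor, tangent direction**: `2√2/(s₁V) + 2 ≤ (2√2π√κ + 2e₀)/(ΛN)` for `s₁ = 2Λ/(π√κ)`, `V ≥ N/2 > 0`, `ΛN ≤ e₀`. [folklore] -/
theorem near_tan_le {κ Λ V N e₀ : ℝ} (hκ : 0 < κ) (hΛ : 0 < Λ) (hN : 0 < N) (hV : N / 2 ≤ V) (hΛN : Λ * N ≤ e₀) :
    2 * Real.sqrt 2 / (2 * Λ / (π * Real.sqrt κ) * V) + 2 ≤ (2 * Real.sqrt 2 * π * Real.sqrt κ + 2 * e₀) / (Λ * N) := by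
  have hs : 0 < Real.sqrt κ := Real.sqrt_pos.2 hκ
  have h2 : 0 < Real.sqrt 2 := Real.sqrt_pos.2 (by norm_num)
  have hπ := Real.pi_pos
  have hV0 : 0 < V := lt_of_lt_of_le (by positivity) hV
  have e : 2 * Real.sqrt 2 / (2 * Λ / (π * Real.sqrt κ) * V) = Real.sqrt 2 * π * Real.sqrt κ / (Λ * V) := by
    field_simp
  have h1 : Real.sqrt 2 * π * Real.sqrt κ / (Λ * V) ≤ 2 * Real.sqrt 2 * π * Real.sqrt κ / (Λ * N) := by
    calc Real.sqrt 2 * π * Real.sqrt κ / (Λ * V) ≤ Real.sqrt 2 * π * Real.sqrt κ / (Λ * (N / 2)) :=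
          div_le_div_of_nonneg_left (by positivity) (by positivity) (by nlinarith)
      _ = 2 * Real.sqrt 2 * π * Real.sqrt κ / (Λ * N) := by field_simp
  have h3 : (2 : ℝ) ≤ 2 * e₀ / (Λ * N) := by rw [le_div_iff₀ (by positivity)]; linarith
  rw [e, add_div]
  exact add_le_add h1 h3

/-- **Far factor**: with `s₁ = 2Λ/(π√κ)` (`p := 1/s₁ = π√κ/(2Λ)`), `R₀ ≥ L/(12N) > 0`, `LΛ² ≥ 2πe₀²`, `Λ ≤ e₀`:
`16(1/s₁+1)²/(1+s₁R₀) ≤ (96/(πe₀²))·(π√κ/2)(π√κ/2 + e₀)²·N/Λ`. [folklore] -/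
theorem far_le {κ Λ L N R₀ e₀ : ℝ} (hκ : 0 < κ) (hΛ : 0 < Λ) (hL : 0 < L) (hN : 0 < N) (he : 0 < e₀) (hΛe : Λ ≤ e₀)
    (hR₀ : L / (12 * N) ≤ R₀) (hLΛ : 2 * π * e₀ ^ 2 ≤ L * Λ ^ 2) :
    16 * (1 / (2 * Λ / (π * Real.sqrt κ)) + 1) ^ 2 / (1 + 2 * Λ / (π * Real.sqrt κ) * R₀) ≤
      96 / (π * e₀ ^ 2) * ((π * Real.sqrt κ / 2) * (π * Real.sqrt κ / 2 + e₀) ^ 2) * (N / Λ) := by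
  have hs : 0 < Real.sqrt κ := Real.sqrt_pos.2 hκ
  have hπ := Real.pi_pos
  have hR0 : 0 < R₀ := lt_of_lt_of_le (by positivity) hR₀
  -- abbreviate `q = π√κ`
  obtain ⟨q, hq⟩ : ∃ q : ℝ, q = π * Real.sqrt κ := ⟨_, rfl⟩
  have hq0 : 0 < q := by rw [hq]; positivity
  rw [← hq]
  have e1 : 1 / (2 * Λ / q) = q / (2 * Λ) := one_div_div _ _
  rw [e1]
  have hinvR : 1 / R₀ ≤ 12 * N / L := by
    calc 1 / R₀ ≤ 1 / (L / (12 * N)) := one_div_le_one_div_of_le (by positivity) hR₀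
      _ = 12 * N / L := one_div_div _ _
  have hinvL : 1 / L ≤ Λ ^ 2 / (2 * π * e₀ ^ 2) := by
    have h : 2 * π * e₀ ^ 2 / Λ ^ 2 ≤ L := by rw [div_le_iff₀ (by positivity)]; exact hLΛ
    calc 1 / L ≤ 1 / (2 * π * e₀ ^ 2 / Λ ^ 2) := one_div_le_one_div_of_le (by positivity) h
      _ = Λ ^ 2 / (2 * π * e₀ ^ 2) := one_div_div _ _
  have hden : 2 * Λ / q * R₀ ≤ 1 + 2 * Λ / q * R₀ := by linarith
  calc 16 * (q / (2 * Λ) + 1) ^ 2 / (1 + 2 * Λ / q * R₀)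
      ≤ 16 * (q / (2 * Λ) + 1) ^ 2 / (2 * Λ / q * R₀) := div_le_div_of_nonneg_left (by positivity) (by positivity) hden
    _ = 8 * q * (q / 2 + Λ) ^ 2 / Λ ^ 3 * (1 / R₀) := by field_simp; ring
    _ ≤ 8 * q * (q / 2 + e₀) ^ 2 / Λ ^ 3 * (12 * N / L) := by gcongr
    _ = 96 * q * (q / 2 + e₀) ^ 2 * N / Λ ^ 3 * (1 / L) := by ring
    _ ≤ 96 * q * (q / 2 + e₀) ^ 2 * N / Λ ^ 3 * (Λ ^ 2 / (2 * π * e₀ ^ 2)) := by gcongr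
    _ = 96 / (π * e₀ ^ 2) * ((q / 2) * (q / 2 + e₀) ^ 2) * (N / Λ) := by field_simp

/-- **The bracket**: near + far `≤ (N/Λ)·κ_X` with `κ_X = 4ν²/e₀ + (96/(πe₀²))(π√κ/2)(π√κ/2+e₀)²`, `ν = 3√2π√κ + 2e₀`, using `ΛN² = e₀`.
[folklore] -/
theorem bracket_le {κ Λ N e₀ n2 n3 fr : ℝ} (hΛ : 0 < Λ) (hN : 0 < N) (hΛN2 : Λ * N ^ 2 = e₀)
    (hn3 : 0 ≤ n3)
    (h2 : n2 ≤ (3 * Real.sqrt 2 * π * Real.sqrt κ + 2 * e₀) / Λ)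
    (h3 : n3 ≤ (2 * Real.sqrt 2 * π * Real.sqrt κ + 2 * e₀) / (Λ * N))
    (hfr : fr ≤ 96 / (π * e₀ ^ 2) * ((π * Real.sqrt κ / 2) * (π * Real.sqrt κ / 2 + e₀) ^ 2) * (N / Λ)) :
    4 * (n2 * n3) + fr ≤ N / Λ * (4 * (3 * Real.sqrt 2 * π * Real.sqrt κ + 2 * e₀) ^ 2 / e₀ +
      96 / (π * e₀ ^ 2) * ((π * Real.sqrt κ / 2) * (π * Real.sqrt κ / 2 + e₀) ^ 2)) := by
  have he : 0 < e₀ := by rw [← hΛN2]; positivity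
  have hs : 0 ≤ Real.sqrt κ := Real.sqrt_nonneg κ
  have h2' : 0 ≤ Real.sqrt 2 := Real.sqrt_nonneg 2
  have hπ := Real.pi_pos
  obtain ⟨ν, hν⟩ : ∃ ν : ℝ, ν = 3 * Real.sqrt 2 * π * Real.sqrt κ + 2 * e₀ := ⟨_, rfl⟩
  have hν0 : 0 ≤ ν := by rw [hν]; positivity
  have hle : 2 * Real.sqrt 2 * π * Real.sqrt κ + 2 * e₀ ≤ ν := by rw [hν]; nlinarith [mul_nonneg (mul_nonneg h2' hπ.le) hs]
  have h3' : n3 ≤ ν / (Λ * N) := h3.trans (div_le_div_of_nonneg_right hle (by positivity))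
  rw [← hν] at h2 ⊢
  have hprod : n2 * n3 ≤ (ν / Λ) * (ν / (Λ * N)) := mul_le_mul h2 h3' hn3 (by positivity)
  have e : (ν / Λ) * (ν / (Λ * N)) = N / Λ * (ν ^ 2 / e₀) := by
    rw [← hΛN2]; field_simp
  rw [e] at hprod
  have : N / Λ * (4 * ν ^ 2 / e₀ + 96 / (π * e₀ ^ 2) * ((π * Real.sqrt κ / 2) * (π * Real.sqrt κ / 2 + e₀) ^ 2)) =
      4 * (N / Λ * (ν ^ 2 / e₀)) + 96 / (π * e₀ ^ 2) * ((π * Real.sqrt κ / 2) * (π * Real.sqrt κ / 2 + e₀) ^ 2) * (N / Λ) := by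
    ring
  rw [this]
  linarith

/-- **The support factor**: with `ρ ≤ ρ̄/N`, `ΛN² = e₀`, `N² ≤ L`, `1 ≤ N`, `π/(4β) ≤ Λ`:
`(Λβ/π + 1)(√2L((Λ + K₂ρ²)/γ)/π + 2)(√2L(2ρ)/π + 2) ≤ (5Λβ/π)(L²/N³)·c_N1·c_N2`,
`c_N1 = √2(e₀ + K₂ρ̄²)/(γπ) + 2`, `c_N2 = 2√2ρ̄/π + 2`. [folklore] -/
theorem supp_le {Λ β L N ρ ρb e₀ K₂ γ : ℝ} (hΛ : 0 < Λ) (hβ : 0 < β) (hL : 0 < L) (hN : 1 ≤ N) (hρ : 0 ≤ ρ) (hρb : ρ ≤ ρb / N)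
    (hK₂ : 0 ≤ K₂) (hγ : 0 < γ) (hΛN2 : Λ * N ^ 2 = e₀) (hNL : N ^ 2 ≤ L) (hΛβ : π / (4 * β) ≤ Λ) :
    (Λ * β / π + 1) * ((Real.sqrt 2 * L * ((Λ + K₂ * ρ ^ 2) / γ) / π + 2) * (Real.sqrt 2 * L * (2 * ρ) / π + 2)) ≤
      5 * Λ * β / π * (L ^ 2 / N ^ 3) * ((Real.sqrt 2 * (e₀ + K₂ * ρb ^ 2) / (γ * π) + 2) * (2 * Real.sqrt 2 * ρb / π + 2)) := by
  have hπ := Real.pi_pos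
  have h2 : 0 ≤ Real.sqrt 2 := Real.sqrt_nonneg 2
  have hN0 : 0 < N := by linarith
  have he : 0 < e₀ := by rw [← hΛN2]; positivity
  have hρb0 : 0 ≤ ρb := by
    have h := hρ.trans hρb
    rw [le_div_iff₀ hN0] at h; nlinarith
  -- first factor
  have hA : Λ * β / π + 1 ≤ 5 * Λ * β / π := by
    have h4 : π ≤ 4 * β * Λ := by rw [div_le_iff₀ (by positivity)] at hΛβ; linarith
    rw [div_add_one (ne_of_gt hπ), div_le_div_iff_of_pos_right hπ]
    nlinarith
  -- second factor
  have hΛe : Λ = e₀ / N ^ 2 := by rw [← hΛN2]; field_simp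
  have hρ2 : ρ ^ 2 ≤ ρb ^ 2 / N ^ 2 := by rw [← div_pow]; exact pow_le_pow_left₀ hρ hρb 2
  have hB : Real.sqrt 2 * L * ((Λ + K₂ * ρ ^ 2) / γ) / π + 2 ≤ L / N ^ 2 * (Real.sqrt 2 * (e₀ + K₂ * ρb ^ 2) / (γ * π) + 2) := by
    have h1 : Λ + K₂ * ρ ^ 2 ≤ (e₀ + K₂ * ρb ^ 2) / N ^ 2 := by
      calc Λ + K₂ * ρ ^ 2 ≤ e₀ / N ^ 2 + K₂ * (ρb ^ 2 / N ^ 2) := by rw [hΛe]; gcongr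
        _ = (e₀ + K₂ * ρb ^ 2) / N ^ 2 := by ring
    have h2' : Real.sqrt 2 * L * ((Λ + K₂ * ρ ^ 2) / γ) / π ≤ L / N ^ 2 * (Real.sqrt 2 * (e₀ + K₂ * ρb ^ 2) / (γ * π)) := by
      calc Real.sqrt 2 * L * ((Λ + K₂ * ρ ^ 2) / γ) / π ≤ Real.sqrt 2 * L * (((e₀ + K₂ * ρb ^ 2) / N ^ 2) / γ) / π := by
            gcongr
        _ = L / N ^ 2 * (Real.sqrt 2 * (e₀ + K₂ * ρb ^ 2) / (γ * π)) := by field_simp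
    have h3 : (2 : ℝ) ≤ L / N ^ 2 * 2 := by
      rw [div_mul_eq_mul_div, le_div_iff₀ (by positivity)]; linarith
    rw [mul_add]; linarith
  -- third factor
  have hC : Real.sqrt 2 * L * (2 * ρ) / π + 2 ≤ L / N * (2 * Real.sqrt 2 * ρb / π + 2) := by
    have h1 : Real.sqrt 2 * L * (2 * ρ) / π ≤ L / N * (2 * Real.sqrt 2 * ρb / π) := by
      calc Real.sqrt 2 * L * (2 * ρ) / π ≤ Real.sqrt 2 * L * (2 * (ρb / N)) / π := by gcongr
        _ = L / N * (2 * Real.sqrt 2 * ρb / π) := by field_simp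
    have hN1 : N ≤ L := by nlinarith
    have h3 : (2 : ℝ) ≤ L / N * 2 := by
      rw [div_mul_eq_mul_div, le_div_iff₀ hN0]; linarith
    rw [mul_add]; linarith
  have hB0 : 0 ≤ Real.sqrt 2 * L * ((Λ + K₂ * ρ ^ 2) / γ) / π + 2 := by positivity
  have hC0 : 0 ≤ Real.sqrt 2 * L * (2 * ρ) / π + 2 := by positivity
  calc _ ≤ (5 * Λ * β / π) * ((L / N ^ 2 * (Real.sqrt 2 * (e₀ + K₂ * ρb ^ 2) / (γ * π) + 2)) *
        (L / N * (2 * Real.sqrt 2 * ρb / π + 2))) :=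
        mul_le_mul hA (mul_le_mul hB hC hC0 (hB0.trans hB)) (by positivity) (by positivity)
    _ = _ := by field_simp

/-- **The product of the two square roots**: if `0 ≤ X₁ ≤ a·(M/(Λβ))·(N/Λ)`, `0 ≤ X₂ ≤ b·M·(Λβ)·(L²·(L²/N³))` and `ΛN² = e₀` then
`√X₁·√X₂·1 ≤ √(ab/e₀)·M·L²`. [folklore] -/
theorem sqrt_mul_sqrt_le {X₁ X₂ a b M Λ β N L e₀ : ℝ} (hX₁ : 0 ≤ X₁) (hX₂ : 0 ≤ X₂) (ha : 0 ≤ a) (hb : 0 ≤ b) (hM : 0 ≤ M)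
    (hΛ : 0 < Λ) (hβ : 0 < β) (hN : 0 < N) (hΛN2 : Λ * N ^ 2 = e₀)
    (h1 : X₁ ≤ a * (M / (Λ * β)) * (N / Λ)) (h2 : X₂ ≤ b * M * (Λ * β) * (L ^ 2 * (L ^ 2 / N ^ 3))) :
    Real.sqrt X₁ * Real.sqrt X₂ * 1 ≤ Real.sqrt (a * b / e₀) * M * L ^ 2 := by
  have he : 0 < e₀ := by rw [← hΛN2]; positivity
  rw [mul_one, ← Real.sqrt_mul hX₁]
  have hprod : X₁ * X₂ ≤ a * b / e₀ * (M * L ^ 2) ^ 2 := by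
    calc X₁ * X₂ ≤ (a * (M / (Λ * β)) * (N / Λ)) * (b * M * (Λ * β) * (L ^ 2 * (L ^ 2 / N ^ 3))) :=
          mul_le_mul h1 h2 hX₂ (hX₁.trans h1)
      _ = a * b / e₀ * (M * L ^ 2) ^ 2 := by rw [← hΛN2]; field_simp
  calc Real.sqrt (X₁ * X₂) ≤ Real.sqrt (a * b / e₀ * (M * L ^ 2) ^ 2) := Real.sqrt_le_sqrt hprod
    _ = Real.sqrt (a * b / e₀) * (M * L ^ 2) := by
        rw [Real.sqrt_mul (by positivity), Real.sqrt_sq (by positivity)]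
    _ = _ := by ring

end Summit.HubbardSuperconductivity.HubbardSuperconductivity.Theorems.TorusFourierL2

end
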